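import Literature.NumberTheory.GaloisRepresentations.PowerSeriesTopNilpotentContinuous
import Mathlib.NumberTheory.Padics.ProperSpace
import HarnessLib

/-!
# Crux 4 (`BSDpOnCellC`), line telescope, leaf N1 `stub_branchLattice`: the hypothesis `hΛ` of the cofree realisation for the
PRODUCT (`(p, X)`-adic) topology on `ℤ_p⟦X⟧`

x2-p2 g23's brick `TelescopeBranchCofreeRealisation.exists_cofreeRealisation` (p766135) realises a framed continuous
`ρ : G →ₜ* GL_n(ℤ_p⟦X⟧)` on the discrete cofree module `(Λ^∨)ⁿ` for ANY ring topology on `ℤ_p⟦X⟧` in which the ideals `(C p^k, X^m)` are open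
(its hypothesis `hΛ`). The Galois-side supplier proposed for N1 (memo `Cruxes/BSDpOnCellC/T-GAL-FACTTEXT.md`, §3–§4) delivers `ρ` for the
coefficientwise = product topology `PowerSeries.WithPiTopology` (in which `ℤ_p⟦X⟧` is compact and which is the topology used by the tree's
`PowerSeriesTopNilpotentContinuous`). This file discharges `hΛ` for that topology, for any coefficient ring `R` and any element `a` such that the
ideal `a^k R` is open (`isOpen_span_C_pow_X_pow`; no new definitions), and specialises to `R = ℤ_[p]`, `a = p` (`isOpen_span_C_p_pow_X_pow`), token-compatible with
the brick's `hΛ`. Helper only (`--supports stmt-BirchSwinnertonDyer-19034 --as helper`); no registered stub, crux or summit statement is proved;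
BSD is proved for no curve.

References: [BourbakiGT1] N. Bourbaki, *General Topology* Ch. I §4.1 (product topology: a basic neighbourhood constrains finitely many
coordinates), Ch. III §1.2 (a subgroup containing a neighbourhood of the identity is open). [Greenberg2006] R. Greenberg, *On the structure of certain Galois
cohomology groups*, Doc. Math. Extra Vol. (2006) p. 342 (the discrete module `T ⊗_Λ Λ^∨`). [Hida1986] H. Hida, Invent. Math. 85 (1986) Thm. 2.1 (the
`𝔪`-adically continuous big ordinary representation whose base change to `ℤ_p⟦X⟧` is the intended `ρ`).
-/

noncomputable section

set_option linter.dupNamespace false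

open scoped PowerSeries.WithPiTopology Topology
open Literature.NumberTheory.GaloisRepresentations

namespace Summit.BirchSwinnertonDyer.BirchSwinnertonDyer.Theorems.TelescopeBranchPiTopologyOpenIdeals

section Generic

variable {R : Type*} [CommRing R]

/-- A power series all of whose coefficients lie in the principal ideal `(b)` lies in `(C b)`: choose `c_j` with `c_j b = coeff j T`,
then `T = (mk c) · C b`. [cite: BourbakiGT1, Ch. I §4.1] -/
theorem mem_span_C_of_forall_coeff_mem {b : R} {T : PowerSeries R}
    (h : ∀ j : ℕ, PowerSeries.coeff j T ∈ Ideal.span {b}) :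
    T ∈ Ideal.span {PowerSeries.C b} := by
  choose c hc using fun j => Ideal.mem_span_singleton'.mp (h j)
  refine Ideal.mem_span_singleton'.mpr ⟨PowerSeries.mk c, ?_⟩
  ext j
  rw [PowerSeries.coeff_mul_C, PowerSeries.coeff_mk, hc]

/-- A power series all of whose coefficients below `m` lie in `(a^k)` lies in the ideal `(C a^k, X^m)`: split `F = T + (F − T)` with
`T = Σ_{j<m} (coeff j F) X^j ∈ (C a^k)` and `X^m ∣ F − T`. [cite: BourbakiGT1, Ch. I §4.1] -/
theorem mem_span_pair_of_coeff_mem {a : R} {k m : ℕ} {F : PowerSeries R}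
    (hF : ∀ i < m, PowerSeries.coeff i F ∈ Ideal.span {a ^ k}) :
    F ∈ Ideal.span {PowerSeries.C (a ^ k), (PowerSeries.X : PowerSeries R) ^ m} := by
  classical
  set T : PowerSeries R := PowerSeries.mk fun j => if j < m then PowerSeries.coeff j F else 0 with hT
  have hTc : ∀ j : ℕ, PowerSeries.coeff j T = if j < m then PowerSeries.coeff j F else 0 := fun j => by
    rw [hT, PowerSeries.coeff_mk]
  have h1 : T ∈ Ideal.span {PowerSeries.C (a ^ k)} := by
    refine mem_span_C_of_forall_coeff_mem fun j => ?_
    rw [hTc]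
    split_ifs with hj
    · exact hF j hj
    · exact Ideal.zero_mem _
  have h2 : (PowerSeries.X : PowerSeries R) ^ m ∣ F - T := by
    rw [PowerSeries.X_pow_dvd_iff]
    intro j hj
    rw [map_sub, hTc, if_pos hj, sub_self]
  obtain ⟨u, hu⟩ := Ideal.mem_span_singleton'.mp h1
  obtain ⟨G, hG⟩ := h2
  refine Ideal.mem_span_pair.mpr ⟨u, G, ?_⟩
  rw [hu, mul_comm G, ← hG]
  ring

/-- The coefficient box `{F | ∀ i < m, coeff i F ∈ U}` is open in the product topology when `U` is. [cite: BourbakiGT1, Ch. I §4.1 Prop. 1] -/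
theorem isOpen_coeffBox [TopologicalSpace R] {U : Set R} (hU : IsOpen U) (m : ℕ) :
    IsOpen {F : PowerSeries R | ∀ i < m, PowerSeries.coeff i F ∈ U} := by
  have e : {F : PowerSeries R | ∀ i < m, PowerSeries.coeff i F ∈ U} =
      ⋂ i ∈ Finset.range m, (fun F : PowerSeries R => PowerSeries.coeff i F) ⁻¹' U := by
    ext F; simp [Finset.mem_range]
  rw [e]
  exact isOpen_biInter_finset fun i _ => hU.preimage (PowerSeries.WithPiTopology.continuous_coeff R i)

/-- **`(C a^k, X^m)` is open in `R⟦X⟧` (product topology) as soon as `(a^k)` is open in `R`**: it contains the open coefficient box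
`{F | ∀ i < m, coeff i F ∈ (a^k)}` around each of its points... precisely: an ideal (additive subgroup) containing an open neighbourhood of `0` is open.
[cite: BourbakiGT1, Ch. III §1.2 (open subgroups), Ch. I §4.1] -/
theorem isOpen_span_C_pow_X_pow [TopologicalSpace R] [IsTopologicalRing R] {a : R} {k : ℕ}
    (ha : IsOpen ((Ideal.span {a ^ k} : Ideal R) : Set R)) (m : ℕ) :
    IsOpen ((Ideal.span {PowerSeries.C (a ^ k), (PowerSeries.X : PowerSeries R) ^ m} : Ideal (PowerSeries R)) :
      Set (PowerSeries R)) := by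
  apply AddSubgroup.isOpen_of_mem_nhds
    (Ideal.span {PowerSeries.C (a ^ k), (PowerSeries.X : PowerSeries R) ^ m}).toAddSubgroup (g := 0)
  refine Filter.mem_of_superset ((isOpen_coeffBox ha m).mem_nhds ?_) ?_
  · intro i _
    simp
  · intro F hF
    exact mem_span_pair_of_coeff_mem hF

end Generic

section PadicInt

variable {p : ℕ} [Fact p.Prime]

/-- The ideal `p^k ℤ_p` is open in `ℤ_p` (it is the closed ball of radius `p^{-k}`, open in an ultrametric space). Same statement as
`Summit.Ventures.HodgeRepro2.T5PadicOpenSubgroups.isOpen_span_pow` in another summit tree (not importable here). [cite: BourbakiGT1, Ch. III §1.2] [folklore] -/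
theorem PadicInt.isOpen_span_p_pow (k : ℕ) : IsOpen ((Ideal.span {(p : ℤ_[p]) ^ k} : Ideal ℤ_[p]) : Set ℤ_[p]) := by
  have e : ((Ideal.span {(p : ℤ_[p]) ^ k} : Ideal ℤ_[p]) : Set ℤ_[p]) = Metric.closedBall (0 : ℤ_[p]) ((p : ℝ) ^ (-(k : ℤ))) := by
    ext x
    simp only [SetLike.mem_coe, Metric.mem_closedBall, dist_zero_right]
    exact (PadicInt.norm_le_pow_iff_mem_span_pow x k).symm
  rw [e]
  have hp : (0 : ℝ) < (p : ℝ) ^ (-(k : ℤ)) := zpow_pos (by exact_mod_cast (Fact.out : p.Prime).pos) _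
  exact IsUltrametricDist.isOpen_closedBall 0 hp.ne'

/-- **`hΛ` for the product topology on `ℤ_p⟦X⟧`**: every ideal `(C p^k, X^m)` is open — verbatim the hypothesis `hΛ` of
`TelescopeBranchCofreeRealisation.exists_cofreeRealisation` / `exists_isOpen_ideal_annihilating`, for the topology `PowerSeries.WithPiTopology`.
[cite: BourbakiGT1, Ch. I §4.1, Ch. III §1.2] [cite: Greenberg2006, p. 342] [cite: Hida1986, Thm. 2.1] -/
theorem isOpen_span_C_p_pow_X_pow (k m : ℕ) :
    IsOpen ((Ideal.span {PowerSeries.C ((p : ℤ_[p]) ^ k), (PowerSeries.X : PowerSeries ℤ_[p]) ^ m} :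
      Ideal (PowerSeries ℤ_[p])) : Set (PowerSeries ℤ_[p])) :=
  isOpen_span_C_pow_X_pow (PadicInt.isOpen_span_p_pow k) m

/-- The same with the quantifiers of `hΛ` in front (`∀ k m`), ready to be passed as the argument `hΛ`. [cite: BourbakiGT1, Ch. I §4.1, Ch. III §1.2] -/
theorem hΛ_piTopology :
    ∀ k m : ℕ, IsOpen ((Ideal.span {PowerSeries.C ((p : ℤ_[p]) ^ k), (PowerSeries.X : PowerSeries ℤ_[p]) ^ m} :
      Ideal (PowerSeries ℤ_[p])) : Set (PowerSeries ℤ_[p])) :=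
  isOpen_span_C_p_pow_X_pow

/-- `ℤ_p⟦X⟧` is compact in the product topology (so a continuous framed representation into `GL₂(ℤ_p⟦X⟧)` has compact image) — the tree's
`PowerSeries.WithPiTopology.compactSpace` at `R = ℤ_[p]`. [cite: BourbakiGT1, Ch. I §9.5 Th. 3] -/
theorem compactSpace_powerSeries_padicInt : CompactSpace (PowerSeries ℤ_[p]) :=
  PowerSeries.WithPiTopology.compactSpace ℤ_[p]

end PadicInt

end Summit.BirchSwinnertonDyer.BirchSwinnertonDyer.Theorems.TelescopeBranchPiTopologyOpenIdeals

end
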